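import Summits.HodgeConjecture.HodgeConjecture.Theorems.VHCAbelianSchemesRoadIsogenyPushforwardExtRankTransfer
import Literature.AlgebraicGeometry.Modules.PullbackPushforwardDerivedAdjunction
import Literature.AlgebraicGeometry.Modules.PushforwardLinear
import HarnessLib

/-!
# Road №4 (`VHCAbelianSchemesRoad`) — the `Ext`-adjunction (Adj) of THEOREM T′ (crux stmt-HodgeConjecture-26512) ON BOUNDED
# VECTOR-BUNDLE COMPLEXES, by route K WITHOUT flat pull-back (second, independent discharge of the input piece (R) consumes)

research route conditional on HC_CM; not a corollary; Q11.4-sentence-2 already refuted in dim ≥ 3.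

Seat core-w5 (width copy of core-D; director-hodge g16 R16.11 (1)–(2): «ROUTE K … IS THE KEYSTONE»; «(Adj) gets two independent
discharges … both welcome»). `--supports stmt-HodgeConjecture-26512 --as helper`; closes no stub by itself. The in-house node (R)
`IsogenyPushforwardExtRankTransfer` (p638304) is ALREADY a theorem by seat core-w7's `isogenyPushforwardExtRankTransfer_holds`
(`…ExtAdjunctionHolds.lean`, p650771: full (Adj) for ALL `M•`, through core-qc's flat pull-back `preservesMonomorphisms_pullback_of_flat`);
this file lands the INDEPENDENT second route announced by core-w5 (HOME INBOX l.5575) for the only instance piece (R) consumes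
(`M• := g_*E•`, a bounded vector-bundle complex): it uses NEITHER the flatness of `g` NOR stalks — for vector-bundle `M•` the flasqueness
of `𝓗om(Mᵖ, g_*Iⁿ)` replaces the injectivity of `g_*Iⁿ`. (The rank identity (R) itself is not restated: one statement, one module —
`isogenyPushforwardExtRankTransfer_holds`; running core-R's `isogenyPushforwardExtRankTransfer_of_hypotheses` chain with the theorem below
in place of (Adj) reproves it verbatim.) Nothing here says (SC), T′, (c1), 26511 ∕ 26512 ∕ 23176, `HC_AV`, `HC_CM` or HC holds; HC_CM
HELD, by name only.

## Content

* `pullbackPushforwardExtAdjunction_of_isBoundedVBComplex` — **(Adj) for bounded complexes of vector bundles**: for an isogeny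
  `g : A → A` of a complex abelian variety, a BOUNDED VECTOR-BUNDLE complex `M•` and a bounded vector-bundle complex `E•`,
  `Hom_D(Q(g^*M•), Q(E•)⟦k⟧) ≃ₗ[ℂ] Hom_D(Q M•, Q(g_*E•)⟦k⟧)` — the displayed shape of core-R's `PullbackPushforwardExtAdjunction` (p644270)
  with `M•` restricted to bounded vector-bundle complexes, which is all that piece (R) consumes (`M• := g_*E•`). PROVED by route K
  (`Literature/AlgebraicGeometry/Modules/PullbackPushforwardDerivedAdjunction.lean`): injective resolution `E• → I•`, `I•⟦k⟧`
  K-injective, termwise adjunction on homotopy classes, `Hom_K(M•, g_*I•⟦k⟧) = Hom_D` because `Extⁱ(Mᵖ, g_*Iⁿ) = Hⁱ(𝓗om(Mᵖ, g_*Iⁿ)) = 0`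
  (flasque), and Leray `g_*E• ≃ g_*I•` for the affine `g` (Serre, Tag 01XB). NO flatness of `g` and NO derived functor is used; the
  `ℂ`-linearity is that of `g_*` over `Spec ℂ` (`Modules/PushforwardLinear`).
References: [cite: Mukai1978, §3 Prop. 3.12 (p. 249)] [cite: MumfordAV1970, §7 Thm. 4 (p. 72)] [cite: Hartshorne1977, II §5 p. 110,
III Prop. 6.7, III Prop. 8.1] [cite: Lipman2009, Prop. 3.2.3] [cite: StacksProject, Tag 0DVC, Tag 01XC].
-/

noncomputable section

open CategoryTheory CategoryTheory.Limits AlgebraicGeometry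

namespace Summit.HodgeConjecture.HodgeConjecture.Ring2.SemiregularRepresentatives

set_option linter.dupNamespace false -- the cell's namespace repeats the summit name, as in every `Ring2*` file

open Literature.AlgebraicGeometry Literature.AlgebraicGeometry.Motives Literature.AlgebraicGeometry.Motives.AbelianVariety
open Literature.AlgebraicGeometry.KTheory Literature.AlgebraicGeometry.Modules

/-- A bounded complex of vector bundles vanishes below some degree and from some degree on. [cite: Schlichting2011HigherKTheory, §3.1.3] -/
theorem IsBoundedVBComplex.exists_bounds {X : Scheme.{0}} {K : CochainComplex X.Modules ℤ} (hK : IsBoundedVBComplex K) :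
    ∃ a₀ b₀ : ℤ, (∀ p, p < a₀ → IsZero (K.X p)) ∧ (∀ p, b₀ ≤ p → IsZero (K.X p)) := by
  obtain ⟨s, hs⟩ := hK.exists_finset
  obtain ⟨a₀, ha₀⟩ := s.bddBelow
  obtain ⟨b, hb⟩ := s.bddAbove
  refine ⟨a₀, b + 1, fun p hp => hs p fun hps => ?_, fun p hp => hs p fun hps => ?_⟩
  · exact absurd (ha₀ hps) (not_le.mpr hp)
  · exact absurd (hb hps) (not_le.mpr (by omega))

/-- **(Adj) on bounded vector-bundle complexes — PROVED (route K, no flatness).** For an isogeny `g : A → A` of a complex abelian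
variety, a bounded complex of vector bundles `M•` and a bounded complex of vector bundles `E•` on `A`, and every `k : ℤ`:
`Hom_{D(Mod 𝒪_A)}(Q(g^*M•), Q(E•)⟦k⟧) ≃ₗ[ℂ] Hom_{D(Mod 𝒪_A)}(Q M•, Q(g_*E•)⟦k⟧)` — core-R's displayed `PullbackPushforwardExtAdjunction` with `M•`
restricted to bounded vector-bundle complexes (all that piece (R) consumes). Proof: `Modules.shiftedHomLinearEquivPullbackPushforwardOfVectorBundles`
for the affine morphism `g` (an isogeny is finite), `g_*` being `ℂ`-linear over `Spec ℂ`.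
[cite: Lipman2009, Prop. 3.2.3] [cite: Hartshorne1977, II §5 p. 110 and III Prop. 8.1] [cite: StacksProject, Tag 0DVC] -/
theorem pullbackPushforwardExtAdjunction_of_isBoundedVBComplex (A : AbelianVariety ℂ) (g : A ⟶ A) (hg : IsIsogeny g)
    (M E : CochainComplex A.X.left.Modules ℤ) (hM : IsBoundedVBComplex M) (hE : IsBoundedVBComplex E) (k : ℤ) :
    letI := HasDerivedCategory.standard A.X.left.Modules
    Nonempty (ShiftedHom (DerivedCategory.Q.obj (((Scheme.Modules.pullback (Hom.toSchemeHom g)).mapHomologicalComplex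
        (ComplexShape.up ℤ)).obj M)) (DerivedCategory.Q.obj E) k ≃ₗ[ℂ]
      ShiftedHom (DerivedCategory.Q.obj M) (DerivedCategory.Q.obj (endoPushforwardComplex A g E)) k) := by
  letI := HasDerivedCategory.standard A.X.left.Modules
  haveI : IsFinite (Hom.toSchemeHom g) := hg.2
  haveI : (Scheme.Modules.pushforward (Hom.toSchemeHom g)).Linear ℂ := linear_pushforward g.hom.hom.hom
  obtain ⟨a₀, b₀, hMa, hMb⟩ := IsBoundedVBComplex.exists_bounds hM
  obtain ⟨a, _, hEa, _⟩ := IsBoundedVBComplex.exists_bounds hE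
  exact ⟨shiftedHomLinearEquivPullbackPushforwardOfVectorBundles (Hom.toSchemeHom g) M a₀ b₀ hMa hMb
    hM.isFiniteLocallyFree E a hEa hE.isFiniteLocallyFree k⟩

end Summit.HodgeConjecture.HodgeConjecture.Ring2.SemiregularRepresentatives

end
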